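import Summits.HodgeConjecture.HodgeConjecture.Theorems.VHCAbelianSchemesRoadRegimeDefs
import Summits.HodgeConjecture.HodgeConjecture.Theorems.VHCAbelianSchemesRoadTwistedDoor
import Summits.HodgeConjecture.HodgeConjecture.Theorems.Ring2SemiregularRepresentativesVacuity
import HarnessLib

/-!
# Crux `SemiregularSheafRepresentativesTwAt` (stmt-HodgeConjecture-19274), line `birth` — stub `stub_lefschetzRegimeTw` PROVED

research route conditional on HC_CM; not a corollary; Q11.4-sentence-2 already refuted in dim ≥ 3.

THE NULL DATUM CLOSES REGIME 1 FOR EVERY DOOR WITH NULL DATA. In the Lefschetz regime of K-SR♭∃ (`LefAtLefschetzRegime 𝒪`: the class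
`W` is an algebraic Lefschetz class on EVERY fibre) the conclusion is witnessed at the anchor fibre itself (`s₁ := s₀`) by
`I := {p}`, `κ := 0`, `V := 0`, `a := 1`, `Z := −W` — provided the zero family on the single degree `{p}` is `𝒪`-admissible
(`HasNullDatum 𝒪`, the vacuity certificate's notion, p408180). The sheaf door `bfSheafClass C` has null data (the zero sheaf is
finite locally free, `I`-semiregular, `ch = 0`: `hasNullDatum_bfSheafClass`), and so does the TWISTED door
`twistedReflexiveClass C Adm` for every admissibility notion `Adm ⊇ bfSingleAdmissible` (along the landed widening
`bfSheafClass C ≤ twistedReflexiveClass C Adm`, p418685) — in particular for the road's `AdmTw := gluableSigmaAdmissible ∨ bfSingleAdmissible`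
(`hAdm := Or.inr`). Hence:

* `lefAtLefschetzRegime_of_hasNullDatum : HasNullDatum 𝒪 → LefAtLefschetzRegime 𝒪` (door-generic);
* `hasNullDatum_twistedReflexiveClass`, `lefAtLefschetzRegime_twistedReflexiveClass` (every `Adm ⊇ bfSingleAdmissible`);
* (the untwisted door `bfSheafClass C` is the aside item 19779's registered stub `stub_lefschetzRegime`, proved in its own file
  `…SemiregularSheafRepresentativesLefAtStubLefschetzRegime.lean` from the same two lemmas);
* **`stub_lefschetzRegimeTw`** — the REGISTERED stub 1 of the skeleton `Cruxes/SemiregularSheafRepresentativesTwAt/Lines/birth.lean`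
  (sha 4a36c642…, ring2 LEAD gen 146), signature verbatim over the importable constant
  `Ring2.SemiregularRepresentatives.LefAtLefschetzRegime` (byte-identical body to the skeleton's local `…BirthTw.LefAtLefschetzRegime`,
  so the lead replaces the `sorry` by `exact Theorems.SemiregularSheafRepresentativesTwAt.stub_lefschetzRegimeTw` — both constants
  unfold to the same term).

After this file the twin crux is `closed modulo {stub_exceptionalRegimeTw}` (the research content; the BC5 rung
`stub_rung_sixfoldMiddleTw` is plan-only and not used by `_of`). Nothing else is claimed: K-SR♭∃, the exceptional regime,
`AbelianSchemeVHC`, `HC_AV` stay OPEN; `HC_CM` occurs nowhere.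

References: [cite: vanGeemen1994HodgeAV, §2.4] [cite: Bloch1972Semiregularity, Remark (7.5)] [cite: BuchweitzFlenner2003, §5 Thm. 5.1]
[cite: Fulton1998, Example 3.2.3].
-/

noncomputable section

open CategoryTheory CategoryTheory.Limits AlgebraicGeometry Topology

-- the cell's namespace repeats the summit name (`Summit.HodgeConjecture.HodgeConjecture…`), as in every `Ring2*` file
set_option linter.dupNamespace false

namespace Summit.HodgeConjecture.HodgeConjecture.Ring2.SemiregularRepresentatives

open Literature.AlgebraicGeometry Literature.AlgebraicGeometry.Motives
open Literature.AlgebraicGeometry.HodgeTheory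
open Literature.AlgebraicTopology.SingularHomology
open Summit.Ventures.HSemireg (ObjClass bfSheafClass)

/-! ## §1 Regime 1 for every door with null data -/

/-- **A door with null data satisfies the Lefschetz regime of K-SR♭∃**: where `W` is an algebraic Lefschetz class on every
fibre, the null datum (`I = {p}`, `κ = 0`, `V = 0`, `a = 1`, `Z = −W`) at the anchor fibre `s₁ := s₀` witnesses the conclusion
(`admissibleRepresentativesLef_pointwise_of_lefschetz`). [cite: vanGeemen1994HodgeAV, §2.4]
[cite: Bloch1972Semiregularity, Remark (7.5)] -/
theorem lefAtLefschetzRegime_of_hasNullDatum {𝒪 : ObjClass} (h𝒪 : HasNullDatum 𝒪) : LefAtLefschetzRegime 𝒪 := by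
  intro n 𝒳 S f hf h𝒳 hirr haff hsm hdim habel he p W hW s₀ hs₀ hL
  obtain ⟨I, κ, V, a, Z, h⟩ := admissibleRepresentativesLef_pointwise_of_lefschetz h𝒪 f W hW hL s₀
  exact ⟨s₀, I, κ, V, a, Z, h⟩

/-! ## §2 The twisted door has null data -/

/-- **The twisted door has null data** for every admissibility notion containing Buchweitz–Flenner's single-bundle notion:
the zero sheaf placed in degree `0` with `B₀ = 0` (the widening `bfSheafClass C ≤ twistedReflexiveClass C Adm` applied to the
sheaf door's null datum). [cite: BuchweitzFlenner2003, §5 Thm. 5.1 (hypotheses)] [cite: Fulton1998, Example 3.2.3] -/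
theorem hasNullDatum_twistedReflexiveClass (C : ChernCharacterBetti) (Adm : PerfectAdmissibility)
    (hAdm : ∀ n X₀ I E, bfSingleAdmissible n X₀ I E → Adm n X₀ I E) :
    HasNullDatum (twistedReflexiveClass C Adm) :=
  fun n X₀ p => bfSheafClass_le_twistedReflexiveClass C hAdm n X₀ {p} _ (hasNullDatum_bfSheafClass C n X₀ p)

/-- **The twisted door satisfies regime 1** for every `Adm ⊇ bfSingleAdmissible`. [cite: vanGeemen1994HodgeAV, §2.4]
[cite: BuchweitzFlenner2003, §5 Thm. 5.1] -/
theorem lefAtLefschetzRegime_twistedReflexiveClass (C : ChernCharacterBetti) (Adm : PerfectAdmissibility)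
    (hAdm : ∀ n X₀ I E, bfSingleAdmissible n X₀ I E → Adm n X₀ I E) :
    LefAtLefschetzRegime (twistedReflexiveClass C Adm) :=
  lefAtLefschetzRegime_of_hasNullDatum (hasNullDatum_twistedReflexiveClass C Adm hAdm)

end Summit.HodgeConjecture.HodgeConjecture.Ring2.SemiregularRepresentatives

/-! ## §3 The registered stub, verbatim -/

namespace Summit.HodgeConjecture.HodgeConjecture.Theorems.SemiregularSheafRepresentativesTwAt

open Literature.AlgebraicGeometry.HodgeTheory
open Summit.HodgeConjecture.HodgeConjecture.Ring2.SemiregularRepresentatives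

/-- **Stub `stub_lefschetzRegimeTw` of crux `SemiregularSheafRepresentativesTwAt` (stmt-HodgeConjecture-19274), line `birth`,
REGISTERED SIGNATURE VERBATIM** — the Lefschetz regime of K-SR♭∃ over the road's twisted door
`twistedReflexiveClass C (gluableSigmaAdmissible ∨ bfSingleAdmissible)`, for every Chern character theory `C`: the null datum
(`hAdm := Or.inr`). [cite: vanGeemen1994HodgeAV, §2.4] [cite: Bloch1972Semiregularity, Remark (7.5)]
[cite: BuchweitzFlenner2003, §5 Thm. 5.1] -/
theorem stub_lefschetzRegimeTw : ∀ C : ChernCharacterBetti, LefAtLefschetzRegime (Literature.AlgebraicGeometry.HodgeTheory.twistedReflexiveClass C (fun n X₀ I E => Summit.Ventures.HSemireg.gluableSigmaAdmissible n X₀ I E ∨ Literature.AlgebraicGeometry.HodgeTheory.bfSingleAdmissible n X₀ I E)) :=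
  fun C => lefAtLefschetzRegime_twistedReflexiveClass C _ (fun _ _ _ _ h => Or.inr h)

end Summit.HodgeConjecture.HodgeConjecture.Theorems.SemiregularSheafRepresentativesTwAt

end
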